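import Summits.CriticalPhenomena.PercolationContinuityZ3.Theorems.PercNearOneGluingNoHeavyLowerTailFrontierDecRowsCutSetup
import Summits.CriticalPhenomena.PercolationContinuityZ3.Theorems.PercNearOneGluingNoHeavyLowerTailFrontierDecRowsRow15CutVertexAYIneq
import Summits.CriticalPhenomena.PercolationContinuityZ3.Theorems.PercNearOneGluingNoHeavyLowerTailFrontierDecRowsRow44CrossCutSide
import Summits.CriticalPhenomena.PercolationContinuityZ3.Theorems.PercNearOneGluingNoHeavyLowerTailFrontierDecRowsConeImplied
import Mathlib.Tactic.Linarith
import HarnessLib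

/-!
# Frontier dec row 15 `E₃(D[ab|c], D[ac|y], D[b|y])` across a `{a,y} | {b,c}` cut vertex (route `PercNearOneGluingNoHeavy`, supports-only; prim-l12-p6 g16)

Support file for crux `stmt-CriticalPhenomena-4575`; memo `run/shared/lean/prim/prim-l12/FROM-prim-l12-p6-g16-ROW37-HUB-IDENTITY.md` §5.
No definitions, no named facts, no sorries.  A cut vertex `h` separates `a, y` (colour `true`) from `b, c` (colour `false`).  Side events:
`EK = {a↔y}`, `EA = {a↔h}`, `EG = {y↔h}` on the near side, `EK' = {b↔c}`, `EC' = {h↔b}`, `EY' = {h↔c}` on the far side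
(independent).  The three glued events and their seven probabilities are polynomials in `k, a, g, t` of each side, and the certificate
`row15_cutVertexAY_ineq` (`…Row15CutVertexAYIneq`, inputs `threePoint_side_facts` and `frontier_43_all`) gives
THEOREM (`sahiE3_row15_nonneg_of_cutVertexAY`): row 15 holds at `(a,b,c,y)` across such a cut — discharging hypothesis `H22ay` of
`frontier_15_all_of_noCut` (`…Row15NoCutVertex`).
-/

noncomputable section

namespace Summit.CriticalPhenomena.PercolationContinuityZ3.Theorems.FrontierDecRows

open MeasureTheory CovTransferCert E3GroupSepCert
open Literature.Probability.Percolation Literature.Probability.LatticeModels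

variable {n : ℕ}

set_option maxHeartbeats 3200000 in
/-- **Row 15 across a `{a,y} | {b,c}` cut vertex.**  `a, y` coloured `true`, `b, c` coloured `false`, every positive-weight edge avoiding `h`
monochromatic: `0 ≤ E₃(D[ab|c], D[ac|y], D[b|y])` at `(a,b,c,y)`. [this work] -/
theorem sahiE3_row15_nonneg_of_cutVertexAY (w : Sym2 (Fin n) → unitInterval) (a b c y h : Fin n) (side : Fin n → Bool)
    (ha : side a = true) (hy : side y = true) (hb : side b = false) (hc : side c = false)
    (hw : ∀ u v : Fin n, u ≠ h → v ≠ h → side u ≠ side v → w s(u, v) = 0) :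
    0 ≤ sahiE3 (prodBernoulli w) (connEvent (row 15 n (a, b, c, y)).1) (connEvent (row 15 n (a, b, c, y)).2.1)
      (connEvent (row 15 n (a, b, c, y)).2.2) := by
  classical
  have hrow : row 15 n (a, b, c, y) = (sep [a, b] [c], sep [a, c] [y], sep [b] [y]) := rfl
  simp only [hrow, connEvent_sep]
  have h32 := frontier_43_all w b c h a
  have hrow32 : row 43 n (b, c, h, a) = (sep [b] [c], sep [b] [h], sep [c] [h]) := rfl
  simp only [hrow32, connEvent_sep] at h32
  set μ := prodBernoulli w with hμ
  have neT : ∀ x z, side x = true → side z = false → x ≠ z := fun x z hx hz e => by rw [e, hz] at hx; exact Bool.false_ne_true hx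
  have hab := neT a b ha hb; have hac := neT a c ha hc; have hyb := neT y b hy hb; have hyc := neT y c hy hc
  set F₁ : Finset (Sym2 (Fin n)) := Finset.univ.filter (fun e => ∀ u ∈ e, side u = true ∨ u = h) with hF₁
  set F₂ : Finset (Sym2 (Fin n)) :=
    Finset.univ.filter (fun e => (∀ u ∈ e, side u = false ∨ u = h) ∧ ¬ ∀ u ∈ e, u = h) with hF₂
  have hdisj : Disjoint F₁ F₂ := cutSides_disjoint side h F₁ F₂ hF₁ hF₂
  set D : Finset (Sym2 (Fin n)) := F₁ ∪ F₂ with hD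
  have hwD : ∀ e, e ∉ D → w e = 0 := fun e he => cutSides_weight_zero w side h F₁ F₂ hF₁ hF₂ hw e (by rwa [hD] at he)
  have pl : ∀ ω : Set (Sym2 (Fin n)), ∀ x z, side x = true → side z = true →
      ((openGraph (ω ∩ ↑D)).Reachable x z ↔ (openGraph (ω ∩ ↑F₁)).Reachable x z) := by
    intro ω x z hx hz; rw [hD]; exact cutSides_reach_left side h F₁ F₂ hF₁ hF₂ ω x z hx hz
  have plh : ∀ ω : Set (Sym2 (Fin n)), ∀ x, side x = true →
      ((openGraph (ω ∩ ↑D)).Reachable x h ↔ (openGraph (ω ∩ ↑F₁)).Reachable x h) := by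
    intro ω x hx; rw [hD]; exact cutSides_reach_h side h F₁ F₂ hF₁ hF₂ ω x hx
  have pc : ∀ ω : Set (Sym2 (Fin n)), ∀ x z, side x = true → side z = false → x ≠ z →
      ((openGraph (ω ∩ ↑D)).Reachable x z ↔
        (openGraph (ω ∩ ↑F₁)).Reachable x h ∧ (openGraph (ω ∩ ↑F₂)).Reachable h z) := by
    intro ω x z hx hz hxz; rw [hD, SimpleGraph.reachable_comm]; exact cutSides_reach_cross side h F₁ F₂ hF₁ hF₂ ω x z hx hz hxz
  have meet' : ∀ ω : Set (Sym2 (Fin n)), ∀ v u u', (openGraph (ω ∩ ↑F₂)).Adj v u → (openGraph (ω ∩ ↑F₁)).Adj v u' → v = h :=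
    fun ω v u u' h2 h1 => cutSides_meet side h F₁ F₂ hF₁ hF₂ ω v u' u h1 h2
  have pr : ∀ ω : Set (Sym2 (Fin n)), ∀ x z, side x = false → side z = false →
      ((openGraph (ω ∩ ↑D)).Reachable x z ↔ (openGraph (ω ∩ ↑F₂)).Reachable x z) := by
    intro ω x z hx hz; rw [hD, cutSides_sup, sup_comm]
    exact reachable_sup_iff_left (meet' ω) (cutSides_iso₁ side h F₁ hF₁ ω x hx) (cutSides_iso₁ side h F₁ hF₁ ω z hz)
  have prh : ∀ ω : Set (Sym2 (Fin n)), ∀ z, side z = false →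
      ((openGraph (ω ∩ ↑D)).Reachable z h ↔ (openGraph (ω ∩ ↑F₂)).Reachable z h) := by
    intro ω z hz; rw [hD, cutSides_sup, sup_comm]
    exact reachable_sup_iff_left (meet' ω) (cutSides_iso₁ side h F₁ hF₁ ω z hz) (fun hh => absurd rfl hh)
  -- side events
  set EK : Set (Set (Sym2 (Fin n))) := {ω | ω ∩ ↑F₁ ∈ (openConn a y : Set (Set (Sym2 (Fin n))))} with hEK
  set EA : Set (Set (Sym2 (Fin n))) := {ω | ω ∩ ↑F₁ ∈ (openConn a h : Set (Set (Sym2 (Fin n))))} with hEA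
  set EG : Set (Set (Sym2 (Fin n))) := {ω | ω ∩ ↑F₁ ∈ (openConn y h : Set (Set (Sym2 (Fin n))))} with hEG
  set EK' : Set (Set (Sym2 (Fin n))) := {ω | ω ∩ ↑F₂ ∈ (openConn b c : Set (Set (Sym2 (Fin n))))} with hEK'
  set EC' : Set (Set (Sym2 (Fin n))) := {ω | ω ∩ ↑F₂ ∈ (openConn h b : Set (Set (Sym2 (Fin n))))} with hEC'
  set EY' : Set (Set (Sym2 (Fin n))) := {ω | ω ∩ ↑F₂ ∈ (openConn h c : Set (Set (Sym2 (Fin n))))} with hEY'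
  set X : Set (Set (Sym2 (Fin n))) := {ω | ∀ x ∈ [a, b], ∀ z ∈ [c], ω ∉ openConn x z} with hX
  set Y : Set (Set (Sym2 (Fin n))) := {ω | ∀ x ∈ [a, c], ∀ z ∈ [y], ω ∉ openConn x z} with hY
  set Z : Set (Set (Sym2 (Fin n))) := {ω | ∀ x ∈ [b], ∀ z ∈ [y], ω ∉ openConn x z} with hZ
  have tX : {ω : Set (Sym2 (Fin n)) | ω ∩ ↑D ∈ X} = EK'ᶜ ∩ (EA ∩ EY')ᶜ := by
    ext ω
    simp only [hX, hEK', hEA, hEY', Set.mem_setOf_eq, Set.mem_compl_iff, Set.mem_inter_iff, openConn, List.mem_cons,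
      List.mem_nil_iff, or_false, forall_eq_or_imp, forall_eq]
    rw [pc ω a c ha hc hac, pr ω b c hb hc]
    tauto
  have tY : {ω : Set (Sym2 (Fin n)) | ω ∩ ↑D ∈ Y} = EKᶜ ∩ (EG ∩ EY')ᶜ := by
    ext ω
    simp only [hY, hEK, hEG, hEY', Set.mem_setOf_eq, Set.mem_compl_iff, Set.mem_inter_iff, openConn, List.mem_cons, List.mem_nil_iff,
      or_false, forall_eq_or_imp, forall_eq]
    rw [pl ω a y ha hy, SimpleGraph.reachable_comm (u := c), pc ω y c hy hc hyc]
  have tZ : {ω : Set (Sym2 (Fin n)) | ω ∩ ↑D ∈ Z} = (EG ∩ EC')ᶜ := by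
    ext ω
    simp only [hZ, hEG, hEC', Set.mem_setOf_eq, Set.mem_compl_iff, Set.mem_inter_iff, openConn, List.mem_singleton, forall_eq]
    rw [SimpleGraph.reachable_comm (u := b), pc ω y b hy hb hyb]
  -- the three-point rows' events
  set S2cy : Set (Set (Sym2 (Fin n))) := {ω | ∀ p ∈ [b], ∀ q ∈ [c], ω ∉ openConn p q} with hS2cy
  set S2ch : Set (Set (Sym2 (Fin n))) := {ω | ∀ p ∈ [b], ∀ q ∈ [h], ω ∉ openConn p q} with hS2ch
  set S2yh : Set (Set (Sym2 (Fin n))) := {ω | ∀ p ∈ [c], ∀ q ∈ [h], ω ∉ openConn p q} with hS2yh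
  have u2cy : {ω : Set (Sym2 (Fin n)) | ω ∩ ↑D ∈ S2cy} = EK'ᶜ := by
    ext ω; simp only [hS2cy, hEK', Set.mem_setOf_eq, List.mem_singleton, forall_eq, Set.mem_compl_iff, openConn]; rw [pr ω b c hb hc]
  have u2ch : {ω : Set (Sym2 (Fin n)) | ω ∩ ↑D ∈ S2ch} = EC'ᶜ := by
    ext ω; simp only [hS2ch, hEC', Set.mem_setOf_eq, List.mem_singleton, forall_eq, Set.mem_compl_iff, openConn]
    rw [prh ω b hb, SimpleGraph.reachable_comm]
  have u2yh : {ω : Set (Sym2 (Fin n)) | ω ∩ ↑D ∈ S2yh} = EY'ᶜ := by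
    ext ω; simp only [hS2yh, hEY', Set.mem_setOf_eq, List.mem_singleton, forall_eq, Set.mem_compl_iff, openConn]
    rw [prh ω c hc, SimpleGraph.reachable_comm]
  have thin : ∀ S : Set (Set (Sym2 (Fin n))), μ.real S = μ.real {ω | ω ∩ ↑D ∈ S} :=
    fun S => real_eq_real_setOf_inter_mem w D hwD S
  have pre_inter : ∀ P Q : Set (Set (Sym2 (Fin n))),
      {ω : Set (Sym2 (Fin n)) | ω ∩ ↑D ∈ P ∩ Q} = {ω | ω ∩ ↑D ∈ P} ∩ {ω | ω ∩ ↑D ∈ Q} := fun P Q => rfl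
  have ms : ∀ S : Set (Set (Sym2 (Fin n))), MeasurableSet S := fun S => (Set.toFinite _).measurableSet
  -- independence of the sides (sets determined by `F₁` resp. `F₂`)
  have indep : ∀ S T : Set (Set (Sym2 (Fin n))), (∀ ω ω' : Set (Sym2 (Fin n)), ω ∩ ↑F₁ = ω' ∩ ↑F₁ → (ω ∈ S ↔ ω' ∈ S)) →
      (∀ ω ω' : Set (Sym2 (Fin n)), ω ∩ ↑F₂ = ω' ∩ ↑F₂ → (ω ∈ T ↔ ω' ∈ T)) → μ.real (S ∩ T) = μ.real S * μ.real T := by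
    intro S T hS hT
    refine prodBernoulli_real_inter_of_determinedBy w F₁ ((determinedBy_iff S _).2 hS) ?_ (ms _) (ms _)
    rw [determinedBy_iff]
    intro ω ω' hω
    have hsub : (↑F₂ : Set (Sym2 (Fin n))) ⊆ (↑F₁ : Set (Sym2 (Fin n)))ᶜ := fun e he he1 =>
      Finset.disjoint_left.1 hdisj (Finset.mem_coe.1 he1) (Finset.mem_coe.1 he)
    have : ω ∩ ↑F₂ = ω' ∩ ↑F₂ := by
      rw [← Set.inter_eq_self_of_subset_right hsub, ← Set.inter_assoc, ← Set.inter_assoc, hω]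
    exact hT ω ω' this
  have d1 : ∀ S : Set (Set (Sym2 (Fin n))), (∀ ω, ω ∈ S ↔ (ω ∩ ↑F₁ ∈ EK) ∨ False) → True := fun _ _ => trivial
  have cpl : ∀ S : Set (Set (Sym2 (Fin n))), μ.real Sᶜ = 1 - μ.real S := by
    intro S; rw [Set.compl_eq_univ_sdiff, measureReal_sdiff (Set.subset_univ _) (ms _)]; simp [hμ]
  have cc2 : ∀ P Q : Set (Set (Sym2 (Fin n))), μ.real (Pᶜ ∩ Qᶜ) = 1 - μ.real P - μ.real Q + μ.real (P ∩ Q) := by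
    intro P Q
    rw [← Set.compl_union, cpl]
    have h1 := measureReal_union_add_inter (μ := μ) (s := P) (ms Q)
    linarith
  have mC : ∀ S H : Set (Set (Sym2 (Fin n))), μ.real (S ∩ Hᶜ) = μ.real S - μ.real (S ∩ H) := by
    intro S H
    have e : S ∩ Hᶜ = S \ (S ∩ H) := by ext ω; simp only [Set.mem_inter_iff, Set.mem_compl_iff, Set.mem_sdiff]; tauto
    rw [e, measureReal_sdiff Set.inter_subset_left (ms _)]
  -- transitivity on each side
  have eKA : EK ∩ EA = EA ∩ EG := by
    ext ω; simp only [hEK, hEA, hEG, Set.mem_inter_iff, Set.mem_setOf_eq, openConn]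
    exact ⟨fun hh => ⟨hh.2, hh.1.symm.trans hh.2⟩, fun hh => ⟨hh.1.trans hh.2.symm, hh.1⟩⟩
  have eKG : EK ∩ EG = EA ∩ EG := by
    ext ω; simp only [hEK, hEA, hEG, Set.mem_inter_iff, Set.mem_setOf_eq, openConn]
    exact ⟨fun hh => ⟨hh.1.trans hh.2, hh.2⟩, fun hh => ⟨hh.1.trans hh.2.symm, hh.2⟩⟩
  have eKC' : EK' ∩ EC' = EC' ∩ EY' := by
    ext ω; simp only [hEK', hEC', hEY', Set.mem_inter_iff, Set.mem_setOf_eq, openConn]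
    exact ⟨fun hh => ⟨hh.2, hh.2.trans hh.1⟩, fun hh => ⟨hh.1.symm.trans hh.2, hh.1⟩⟩
  have eKY' : EK' ∩ EY' = EC' ∩ EY' := by
    ext ω; simp only [hEK', hEC', hEY', Set.mem_inter_iff, Set.mem_setOf_eq, openConn]
    exact ⟨fun hh => ⟨hh.2.trans hh.1.symm, hh.2⟩, fun hh => ⟨hh.1.symm.trans hh.2, hh.2⟩⟩
  have cc3 : ∀ K A G : Set (Set (Sym2 (Fin n))), K ∩ A = A ∩ G → K ∩ G = A ∩ G →
      μ.real (Kᶜ ∩ Aᶜ ∩ Gᶜ) = 1 - μ.real K - μ.real A - μ.real G + 2 * μ.real (A ∩ G) := by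
    intro K A G h1 h2
    have e : Kᶜ ∩ Aᶜ ∩ Gᶜ = (K ∪ (A ∪ G))ᶜ := by ext ω; simp only [Set.mem_inter_iff, Set.mem_compl_iff, Set.mem_union]; tauto
    rw [e, cpl]
    have h3 := measureReal_union_add_inter (μ := μ) (s := K) (ms (A ∪ G))
    have h4 := measureReal_union_add_inter (μ := μ) (s := A) (ms G)
    rw [Set.inter_union_distrib_left, h1, h2, Set.union_self] at h3
    linarith
  have uAG : μ.real (EA ∪ EG) = μ.real EA + μ.real EG - μ.real (EA ∩ EG) := by
    have h4 := measureReal_union_add_inter (μ := μ) (s := EA) (ms EG); linarith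
  have uCY : μ.real (EC' ∪ EY') = μ.real EC' + μ.real EY' - μ.real (EC' ∩ EY') := by
    have h4 := measureReal_union_add_inter (μ := μ) (s := EC') (ms EY'); linarith
  -- determinedness side conditions
  have s1 : ∀ P : Set (Set (Sym2 (Fin n))), ∀ ω ω' : Set (Sym2 (Fin n)), ω ∩ ↑F₁ = ω' ∩ ↑F₁ →
      (ω ∈ {η : Set (Sym2 (Fin n)) | η ∩ ↑F₁ ∈ P} ↔ ω' ∈ {η : Set (Sym2 (Fin n)) | η ∩ ↑F₁ ∈ P}) := by
    intro P ω ω' hω; simp only [Set.mem_setOf_eq, hω]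
  have s2 : ∀ P : Set (Set (Sym2 (Fin n))), ∀ ω ω' : Set (Sym2 (Fin n)), ω ∩ ↑F₂ = ω' ∩ ↑F₂ →
      (ω ∈ {η : Set (Sym2 (Fin n)) | η ∩ ↑F₂ ∈ P} ↔ ω' ∈ {η : Set (Sym2 (Fin n)) | η ∩ ↑F₂ ∈ P}) := by
    intro P ω ω' hω; simp only [Set.mem_setOf_eq, hω]
  -- measures of the near-side pieces: (EA ∪ EG) ∩ EKᶜ, EG ∩ EKᶜ ; far side: EC' ∩ EK'ᶜ, EY' ∩ EK'ᶜ, (EC' ∪ EY') ∩ EK'ᶜ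
  have mAGK : μ.real ((EA ∪ EG) ∩ EKᶜ) = μ.real EA + μ.real EG - 2 * μ.real (EA ∩ EG) := by
    rw [mC, Set.inter_comm, Set.inter_union_distrib_left, eKA, eKG, Set.union_self, uAG]; ring
  have mGK : μ.real (EG ∩ EKᶜ) = μ.real EG - μ.real (EA ∩ EG) := by rw [mC, Set.inter_comm, eKG]
  have mCK : μ.real (EC' ∩ EK'ᶜ) = μ.real EC' - μ.real (EC' ∩ EY') := by rw [mC, Set.inter_comm, eKC']
  have mYK : μ.real (EY' ∩ EK'ᶜ) = μ.real EY' - μ.real (EC' ∩ EY') := by rw [mC, Set.inter_comm, eKY']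
  have mCYK : μ.real ((EC' ∪ EY') ∩ EK'ᶜ) = μ.real EC' + μ.real EY' - 2 * μ.real (EC' ∩ EY') := by
    rw [mC, Set.inter_comm, Set.inter_union_distrib_left, eKC', eKY', Set.union_self, uCY]; ring
  -- the seven probabilities
  have eX : μ.real X = (1 - μ.real EK') - μ.real EA * (μ.real EY' - μ.real (EC' ∩ EY')) := by
    rw [thin, tX]
    have e : EK'ᶜ ∩ (EA ∩ EY')ᶜ = EK'ᶜ \ (EA ∩ (EY' ∩ EK'ᶜ)) := by
      ext ω; simp only [Set.mem_inter_iff, Set.mem_compl_iff, Set.mem_sdiff]; tauto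
    rw [e, measureReal_sdiff (fun ω hω => hω.2.2) (ms _), cpl,
      indep EA (EY' ∩ EK'ᶜ) (s1 _) (fun ω ω' hω => by simp only [hEY', hEK', Set.mem_inter_iff, Set.mem_compl_iff, Set.mem_setOf_eq, hω]), mYK]
  have eY : μ.real Y = (1 - μ.real EK) - (μ.real EG - μ.real (EA ∩ EG)) * μ.real EY' := by
    rw [thin, tY]
    have e : EKᶜ ∩ (EG ∩ EY')ᶜ = EKᶜ \ ((EG ∩ EKᶜ) ∩ EY') := by
      ext ω; simp only [Set.mem_inter_iff, Set.mem_compl_iff, Set.mem_sdiff]; tauto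
    rw [e, measureReal_sdiff (fun ω hω => hω.1.2) (ms _), cpl,
      indep (EG ∩ EKᶜ) EY' (fun ω ω' hω => by simp only [hEG, hEK, Set.mem_inter_iff, Set.mem_compl_iff, Set.mem_setOf_eq, hω]) (s2 _), mGK]
  have eZ : μ.real Z = 1 - μ.real EG * μ.real EC' := by rw [thin, tZ, cpl, indep EG EC' (s1 _) (s2 _)]
  have eXY : μ.real (X ∩ Y) = (1 - μ.real EK) * (1 - μ.real EK') - (μ.real EA + μ.real EG - 2 * μ.real (EA ∩ EG)) * (μ.real EY' - μ.real (EC' ∩ EY')) := by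
    rw [thin, pre_inter, tX, tY]
    have e : (EK'ᶜ ∩ (EA ∩ EY')ᶜ) ∩ (EKᶜ ∩ (EG ∩ EY')ᶜ) = (EKᶜ ∩ EK'ᶜ) \ (((EA ∪ EG) ∩ EKᶜ) ∩ (EY' ∩ EK'ᶜ)) := by
      ext ω; simp only [Set.mem_inter_iff, Set.mem_compl_iff, Set.mem_sdiff, Set.mem_union]; tauto
    have sub : ((EA ∪ EG) ∩ EKᶜ) ∩ (EY' ∩ EK'ᶜ) ⊆ EKᶜ ∩ EK'ᶜ := fun ω hω => ⟨hω.1.2, hω.2.2⟩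
    rw [e, measureReal_sdiff sub (ms _),
      indep EKᶜ EK'ᶜ (fun ω ω' hω => by simp only [hEK, Set.mem_compl_iff, Set.mem_setOf_eq, hω]) (fun ω ω' hω => by simp only [hEK', Set.mem_compl_iff, Set.mem_setOf_eq, hω]),
      indep ((EA ∪ EG) ∩ EKᶜ) (EY' ∩ EK'ᶜ) (fun ω ω' hω => by simp only [hEA, hEG, hEK, Set.mem_union, Set.mem_inter_iff, Set.mem_compl_iff, Set.mem_setOf_eq, hω])
        (fun ω ω' hω => by simp only [hEY', hEK', Set.mem_inter_iff, Set.mem_compl_iff, Set.mem_setOf_eq, hω]), cpl, cpl, mAGK, mYK]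
  have eXZ : μ.real (X ∩ Z) = (1 - μ.real EK') - (μ.real EA * (μ.real EY' - μ.real (EC' ∩ EY')) + μ.real EG * (μ.real EC' - μ.real (EC' ∩ EY'))) := by
    rw [thin, pre_inter, tX, tZ]
    have e : (EK'ᶜ ∩ (EA ∩ EY')ᶜ) ∩ (EG ∩ EC')ᶜ = EK'ᶜ \ ((EA ∩ (EY' ∩ EK'ᶜ)) ∪ (EG ∩ (EC' ∩ EK'ᶜ))) := by
      ext ω; simp only [Set.mem_inter_iff, Set.mem_compl_iff, Set.mem_sdiff, Set.mem_union]
      constructor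
      · rintro ⟨⟨hk', hx⟩, hz⟩
        refine ⟨hk', ?_⟩
        rintro (⟨hA, hY', -⟩ | ⟨hG, hC', -⟩)
        · exact hx ⟨hA, hY'⟩
        · exact hz ⟨hG, hC'⟩
      · rintro ⟨hk', hno⟩
        refine ⟨⟨hk', fun hh => hno (Or.inl ⟨hh.1, hh.2, hk'⟩)⟩, fun hh => ?_⟩
        have hkc : ω ∈ EK' ∩ EC' → False := fun hm => hk' hm.1
        by_cases hc' : ω ∈ EK'
        · exact hk' hc'
        · exact hno (Or.inr ⟨hh.1, hh.2, hc'⟩)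
    have hd : Disjoint (EA ∩ (EY' ∩ EK'ᶜ)) (EG ∩ (EC' ∩ EK'ᶜ)) := by
      rw [Set.disjoint_left]
      intro ω h1 h2
      have hk : ω ∈ EK' ∩ EC' := by rw [eKC']; exact ⟨h2.2.1, h1.2.1⟩
      exact h1.2.2 hk.1
    rw [e, measureReal_sdiff (by
      intro ω hω
      rcases hω with h1 | h2
      · exact h1.2.2
      · exact h2.2.2) (ms _), measureReal_union hd (ms _), cpl,
      indep EA (EY' ∩ EK'ᶜ) (s1 _) (fun ω ω' hω => by simp only [hEY', hEK', Set.mem_inter_iff, Set.mem_compl_iff, Set.mem_setOf_eq, hω]),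
      indep EG (EC' ∩ EK'ᶜ) (s1 _) (fun ω ω' hω => by simp only [hEC', hEK', Set.mem_inter_iff, Set.mem_compl_iff, Set.mem_setOf_eq, hω]), mYK, mCK]
  have eYZ : μ.real (Y ∩ Z) = (1 - μ.real EK) - (μ.real EG - μ.real (EA ∩ EG)) * (μ.real EC' + μ.real EY' - μ.real (EC' ∩ EY')) := by
    rw [thin, pre_inter, tY, tZ]
    have e : (EKᶜ ∩ (EG ∩ EY')ᶜ) ∩ (EG ∩ EC')ᶜ = EKᶜ \ ((EG ∩ EKᶜ) ∩ (EC' ∪ EY')) := by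
      ext ω; simp only [Set.mem_inter_iff, Set.mem_compl_iff, Set.mem_sdiff, Set.mem_union]; tauto
    rw [e, measureReal_sdiff (fun ω hω => hω.1.2) (ms _), cpl,
      indep (EG ∩ EKᶜ) (EC' ∪ EY') (fun ω ω' hω => by simp only [hEG, hEK, Set.mem_inter_iff, Set.mem_compl_iff, Set.mem_setOf_eq, hω])
        (fun ω ω' hω => by simp only [hEC', hEY', Set.mem_union, Set.mem_setOf_eq, hω]), mGK, uCY]
  have eXYZ : μ.real (X ∩ Y ∩ Z) = (1 - μ.real EK) * (1 - μ.real EK') -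
      ((μ.real EA + μ.real EG - 2 * μ.real (EA ∩ EG)) * (μ.real EY' - μ.real (EC' ∩ EY')) + (μ.real EG - μ.real (EA ∩ EG)) * (μ.real EC' - μ.real (EC' ∩ EY'))) := by
    rw [thin, pre_inter, pre_inter, tX, tY, tZ]
    have e : (EK'ᶜ ∩ (EA ∩ EY')ᶜ) ∩ (EKᶜ ∩ (EG ∩ EY')ᶜ) ∩ (EG ∩ EC')ᶜ =
        (EKᶜ ∩ EK'ᶜ) \ ((((EA ∪ EG) ∩ EKᶜ) ∩ (EY' ∩ EK'ᶜ)) ∪ ((EG ∩ EKᶜ) ∩ (EC' ∩ EK'ᶜ))) := by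
      ext ω; simp only [Set.mem_inter_iff, Set.mem_compl_iff, Set.mem_sdiff, Set.mem_union]
      constructor
      · rintro ⟨⟨⟨hk', hx⟩, hk, hy'⟩, hz⟩
        refine ⟨⟨hk, hk'⟩, ?_⟩
        rintro (⟨⟨hAG, -⟩, hY', -⟩ | ⟨⟨hG, -⟩, hC', -⟩)
        · rcases hAG with hA | hG
          · exact hx ⟨hA, hY'⟩
          · exact hy' ⟨hG, hY'⟩
        · exact hz ⟨hG, hC'⟩
      · rintro ⟨⟨hk, hk'⟩, hno⟩
        refine ⟨⟨⟨hk', fun hh => hno (Or.inl ⟨⟨Or.inl hh.1, hk⟩, hh.2, hk'⟩)⟩, hk, fun hh => hno (Or.inl ⟨⟨Or.inr hh.1, hk⟩, hh.2, hk'⟩)⟩,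
          fun hh => hno (Or.inr ⟨⟨hh.1, hk⟩, hh.2, hk'⟩)⟩
    have hd : Disjoint (((EA ∪ EG) ∩ EKᶜ) ∩ (EY' ∩ EK'ᶜ)) ((EG ∩ EKᶜ) ∩ (EC' ∩ EK'ᶜ)) := by
      rw [Set.disjoint_left]
      intro ω h1 h2
      have hk : ω ∈ EK' ∩ EC' := by rw [eKC']; exact ⟨h2.2.1, h1.2.1⟩
      exact h1.2.2 hk.1
    have sub : (((EA ∪ EG) ∩ EKᶜ) ∩ (EY' ∩ EK'ᶜ)) ∪ ((EG ∩ EKᶜ) ∩ (EC' ∩ EK'ᶜ)) ⊆ EKᶜ ∩ EK'ᶜ := by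
      intro ω hω
      rcases hω with h1 | h2
      · exact ⟨h1.1.2, h1.2.2⟩
      · exact ⟨h2.1.2, h2.2.2⟩
    rw [e, measureReal_sdiff sub (ms _), measureReal_union hd (ms _),
      indep EKᶜ EK'ᶜ (fun ω ω' hω => by simp only [hEK, Set.mem_compl_iff, Set.mem_setOf_eq, hω]) (fun ω ω' hω => by simp only [hEK', Set.mem_compl_iff, Set.mem_setOf_eq, hω]),
      indep ((EA ∪ EG) ∩ EKᶜ) (EY' ∩ EK'ᶜ) (fun ω ω' hω => by simp only [hEA, hEG, hEK, Set.mem_union, Set.mem_inter_iff, Set.mem_compl_iff, Set.mem_setOf_eq, hω])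
        (fun ω ω' hω => by simp only [hEY', hEK', Set.mem_inter_iff, Set.mem_compl_iff, Set.mem_setOf_eq, hω]),
      indep (EG ∩ EKᶜ) (EC' ∩ EK'ᶜ) (fun ω ω' hω => by simp only [hEG, hEK, Set.mem_inter_iff, Set.mem_compl_iff, Set.mem_setOf_eq, hω])
        (fun ω ω' hω => by simp only [hEC', hEK', Set.mem_inter_iff, Set.mem_compl_iff, Set.mem_setOf_eq, hω]), cpl, cpl, mAGK, mYK, mGK, mCK]
  -- the three-point rows in the side variables
  rw [sahiE3_def] at h32
  have z0 : μ.real (S2cy ∩ S2ch ∩ S2yh) = 1 - μ.real EK' - μ.real EC' - μ.real EY' + 2 * μ.real (EC' ∩ EY') := by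
    rw [thin, pre_inter, pre_inter, u2cy, u2ch, u2yh]; exact cc3 EK' EC' EY' eKC' eKY'
  have z1 : μ.real S2cy = 1 - μ.real EK' := by rw [thin, u2cy, cpl]
  have z2 : μ.real S2ch = 1 - μ.real EC' := by rw [thin, u2ch, cpl]
  have z3 : μ.real S2yh = 1 - μ.real EY' := by rw [thin, u2yh, cpl]
  have z4 : μ.real (S2ch ∩ S2yh) = 1 - μ.real EC' - μ.real EY' + μ.real (EC' ∩ EY') := by rw [thin, pre_inter, u2ch, u2yh, cc2]
  have z5 : μ.real (S2cy ∩ S2yh) = 1 - μ.real EK' - μ.real EY' + μ.real (EC' ∩ EY') := by rw [thin, pre_inter, u2cy, u2yh, cc2, eKY']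
  have z6 : μ.real (S2cy ∩ S2ch) = 1 - μ.real EK' - μ.real EC' + μ.real (EC' ∩ EY') := by rw [thin, pre_inter, u2cy, u2ch, cc2, eKC']
  rw [z0, z1, z2, z3, z4, z5, z6] at h32
  -- cells and Harris on both sides
  have upPre₁ : ∀ u v : Fin n, IsUpperSet {ω : Set (Sym2 (Fin n)) | ω ∩ ↑F₁ ∈ (openConn u v : Set (Set (Sym2 (Fin n))))} :=
    fun u v ω ω' hle hω => isUpperSet_openConn u v (Set.inter_subset_inter_left _ hle) hω
  have upPre₂ : ∀ u v : Fin n, IsUpperSet {ω : Set (Sym2 (Fin n)) | ω ∩ ↑F₂ ∈ (openConn u v : Set (Set (Sym2 (Fin n))))} :=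
    fun u v ω ω' hle hω => isUpperSet_openConn u v (Set.inter_subset_inter_left _ hle) hω
  have trK : EA ∩ EG ⊆ EK := fun ω hω => by rw [← eKA] at hω; exact hω.1
  have trG : EA ∩ EK ⊆ EG := fun ω hω => by
    have : ω ∈ EK ∩ EA := ⟨hω.2, hω.1⟩
    rw [eKA] at this; exact this.2
  have trA : EG ∩ EK ⊆ EA := fun ω hω => by
    have : ω ∈ EK ∩ EG := ⟨hω.2, hω.1⟩
    rw [eKG] at this; exact this.1
  have trK' : EC' ∩ EY' ⊆ EK' := fun ω hω => by rw [← eKC'] at hω; exact hω.1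
  have trG' : EC' ∩ EK' ⊆ EY' := fun ω hω => by
    have : ω ∈ EK' ∩ EC' := ⟨hω.2, hω.1⟩
    rw [eKC'] at this; exact this.2
  have trA' : EY' ∩ EK' ⊆ EC' := fun ω hω => by
    have : ω ∈ EK' ∩ EY' := ⟨hω.2, hω.1⟩
    rw [eKY'] at this; exact this.1
  obtain ⟨⟨c14, c11, c12, c13, c10⟩, ⟨ka1, kg1, -⟩, ⟨-, akg1, -⟩, ⟨-, -, -⟩⟩ :=
    threePoint_side_facts w (upPre₁ a y) (upPre₁ a h) (upPre₁ y h) (ms _) (ms _) (ms _) trK trG trA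
  obtain ⟨⟨c24, c21, c22, c23, c20⟩, ⟨-, -, -⟩, ⟨kag2, akg2, -⟩, ⟨-, -, -⟩⟩ :=
    threePoint_side_facts w (upPre₂ b c) (upPre₂ h b) (upPre₂ h c) (ms _) (ms _) (ms _) trK' trG' trA'
  have e10 : 0 ≤ 1 - μ.real EK - μ.real EA - μ.real EG + 2*μ.real (EA ∩ EG) := by linarith
  have e11 : 0 ≤ μ.real EK - μ.real (EA ∩ EG) := sub_nonneg.2 c11
  have e12 : 0 ≤ μ.real EA - μ.real (EA ∩ EG) := sub_nonneg.2 c12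
  have e13 : 0 ≤ μ.real EG - μ.real (EA ∩ EG) := sub_nonneg.2 c13
  have e20 : 0 ≤ 1 - μ.real EK' - μ.real EC' - μ.real EY' + 2*μ.real (EC' ∩ EY') := by linarith
  have e21 : 0 ≤ μ.real EK' - μ.real (EC' ∩ EY') := sub_nonneg.2 c21
  have e22 : 0 ≤ μ.real EC' - μ.real (EC' ∩ EY') := sub_nonneg.2 c22
  have e23 : 0 ≤ μ.real EY' - μ.real (EC' ∩ EY') := sub_nonneg.2 c23
  have hb1_0 : 0 ≤ ((μ.real (EA ∩ EG)) - (μ.real (EA ∩ EG) + (μ.real EA - μ.real (EA ∩ EG))) * (μ.real (EA ∩ EG) + (μ.real EK - μ.real (EA ∩ EG)) + (μ.real EG - μ.real (EA ∩ EG)))) := by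
    have e : ((μ.real (EA ∩ EG)) - (μ.real (EA ∩ EG) + (μ.real EA - μ.real (EA ∩ EG))) * (μ.real (EA ∩ EG) + (μ.real EK - μ.real (EA ∩ EG)) + (μ.real EG - μ.real (EA ∩ EG)))) = μ.real (EA ∩ EG) - μ.real EA * (μ.real EK + μ.real EG - μ.real (EA ∩ EG)) := by ring
    rw [e]; linarith [akg1]
  have hb1_1 : 0 ≤ ((μ.real (EA ∩ EG)) - (μ.real (EA ∩ EG) + (μ.real EK - μ.real (EA ∩ EG))) * (μ.real (EA ∩ EG) + (μ.real EA - μ.real (EA ∩ EG)))) := by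
    have e : ((μ.real (EA ∩ EG)) - (μ.real (EA ∩ EG) + (μ.real EK - μ.real (EA ∩ EG))) * (μ.real (EA ∩ EG) + (μ.real EA - μ.real (EA ∩ EG)))) = μ.real (EA ∩ EG) - μ.real EK * μ.real EA := by ring
    rw [e]; linarith [ka1]
  have hb1_2 : 0 ≤ ((μ.real (EA ∩ EG)) - (μ.real (EA ∩ EG) + (μ.real EK - μ.real (EA ∩ EG))) * (μ.real (EA ∩ EG) + (μ.real EG - μ.real (EA ∩ EG)))) := by
    have e : ((μ.real (EA ∩ EG)) - (μ.real (EA ∩ EG) + (μ.real EK - μ.real (EA ∩ EG))) * (μ.real (EA ∩ EG) + (μ.real EG - μ.real (EA ∩ EG)))) = μ.real (EA ∩ EG) - μ.real EK * μ.real EG := by ring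
    rw [e]; linarith [kg1]
  have hb2_0 : 0 ≤ ((μ.real (EC' ∩ EY')) - (μ.real (EC' ∩ EY') + (μ.real EK' - μ.real (EC' ∩ EY'))) * (μ.real (EC' ∩ EY') + (μ.real EC' - μ.real (EC' ∩ EY')) + (μ.real EY' - μ.real (EC' ∩ EY')))) := by
    have e : ((μ.real (EC' ∩ EY')) - (μ.real (EC' ∩ EY') + (μ.real EK' - μ.real (EC' ∩ EY'))) * (μ.real (EC' ∩ EY') + (μ.real EC' - μ.real (EC' ∩ EY')) + (μ.real EY' - μ.real (EC' ∩ EY')))) = μ.real (EC' ∩ EY') - μ.real EK' * (μ.real EC' + μ.real EY' - μ.real (EC' ∩ EY')) := by ring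
    rw [e]; linarith [kag2]
  have hb2_1 : 0 ≤ ((μ.real (EC' ∩ EY')) - (μ.real (EC' ∩ EY') + (μ.real EC' - μ.real (EC' ∩ EY'))) * (μ.real (EC' ∩ EY') + (μ.real EK' - μ.real (EC' ∩ EY')) + (μ.real EY' - μ.real (EC' ∩ EY')))) := by
    have e : ((μ.real (EC' ∩ EY')) - (μ.real (EC' ∩ EY') + (μ.real EC' - μ.real (EC' ∩ EY'))) * (μ.real (EC' ∩ EY') + (μ.real EK' - μ.real (EC' ∩ EY')) + (μ.real EY' - μ.real (EC' ∩ EY')))) = μ.real (EC' ∩ EY') - μ.real EC' * (μ.real EK' + μ.real EY' - μ.real (EC' ∩ EY')) := by ring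
    rw [e]; linarith [akg2]
  have lb2 : 0 ≤ (2 * ((1 - μ.real EK' - μ.real EC' - μ.real EY' + 2*μ.real (EC' ∩ EY'))) + ((μ.real EC' - μ.real (EC' ∩ EY')) + (μ.real EY' - μ.real (EC' ∩ EY')) + (1 - μ.real EK' - μ.real EC' - μ.real EY' + 2*μ.real (EC' ∩ EY'))) * ((μ.real EK' - μ.real (EC' ∩ EY')) + (μ.real EY' - μ.real (EC' ∩ EY')) + (1 - μ.real EK' - μ.real EC' - μ.real EY' + 2*μ.real (EC' ∩ EY'))) * ((μ.real EK' - μ.real (EC' ∩ EY')) + (μ.real EC' - μ.real (EC' ∩ EY')) + (1 - μ.real EK' - μ.real EC' - μ.real EY' + 2*μ.real (EC' ∩ EY'))) - (((μ.real EC' - μ.real (EC' ∩ EY')) + (μ.real EY' - μ.real (EC' ∩ EY')) + (1 - μ.real EK' - μ.real EC' - μ.real EY' + 2*μ.real (EC' ∩ EY'))) * ((μ.real EK' - μ.real (EC' ∩ EY')) + (1 - μ.real EK' - μ.real EC' - μ.real EY' + 2*μ.real (EC' ∩ EY'))) + ((μ.real EK' - μ.real (EC' ∩ EY')) + (μ.real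 EY' - μ.real (EC' ∩ EY')) + (1 - μ.real EK' - μ.real EC' - μ.real EY' + 2*μ.real (EC' ∩ EY'))) * ((μ.real EC' - μ.real (EC' ∩ EY')) + (1 - μ.real EK' - μ.real EC' - μ.real EY' + 2*μ.real (EC' ∩ EY'))) + ((μ.real EK' - μ.real (EC' ∩ EY')) + (μ.real EC' - μ.real (EC' ∩ EY')) + (1 - μ.real EK' - μ.real EC' - μ.real EY' + 2*μ.real (EC' ∩ EY'))) * ((μ.real EY' - μ.real (EC' ∩ EY')) + (1 - μ.real EK' - μ.real EC' - μ.real EY' + 2*μ.real (EC' ∩ EY'))))) := by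
    have e : (2 * ((1 - μ.real EK' - μ.real EC' - μ.real EY' + 2*μ.real (EC' ∩ EY'))) + ((μ.real EC' - μ.real (EC' ∩ EY')) + (μ.real EY' - μ.real (EC' ∩ EY')) + (1 - μ.real EK' - μ.real EC' - μ.real EY' + 2*μ.real (EC' ∩ EY'))) * ((μ.real EK' - μ.real (EC' ∩ EY')) + (μ.real EY' - μ.real (EC' ∩ EY')) + (1 - μ.real EK' - μ.real EC' - μ.real EY' + 2*μ.real (EC' ∩ EY'))) * ((μ.real EK' - μ.real (EC' ∩ EY')) + (μ.real EC' - μ.real (EC' ∩ EY')) + (1 - μ.real EK' - μ.real EC' - μ.real EY' + 2*μ.real (EC' ∩ EY'))) - (((μ.real EC' - μ.real (EC' ∩ EY')) + (μ.real EY' - μ.real (EC' ∩ EY')) + (1 - μ.real EK' - μ.real EC' - μ.real EY' + 2*μ.real (EC' ∩ EY'))) * ((μ.real EK' - μ.real (EC' ∩ EY')) + (1 - μ.real EK' - μ.real EC' - μ.real EY' + 2*μ.real (EC' ∩ EY'))) + ((μ.real EK' - μ.real (EC' ∩ EY')) + (μ.real EY' - μ.real (EC' ∩ EY')) + (1 -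 μ.real EK' - μ.real EC' - μ.real EY' + 2*μ.real (EC' ∩ EY'))) * ((μ.real EC' - μ.real (EC' ∩ EY')) + (1 - μ.real EK' - μ.real EC' - μ.real EY' + 2*μ.real (EC' ∩ EY'))) + ((μ.real EK' - μ.real (EC' ∩ EY')) + (μ.real EC' - μ.real (EC' ∩ EY')) + (1 - μ.real EK' - μ.real EC' - μ.real EY' + 2*μ.real (EC' ∩ EY'))) * ((μ.real EY' - μ.real (EC' ∩ EY')) + (1 - μ.real EK' - μ.real EC' - μ.real EY' + 2*μ.real (EC' ∩ EY'))))) =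
        2 * (1 - μ.real EK' - μ.real EC' - μ.real EY' + 2 * μ.real (EC' ∩ EY')) + (1 - μ.real EK') * (1 - μ.real EC') * (1 - μ.real EY') - ((1 - μ.real EK') * (1 - μ.real EC' - μ.real EY' + μ.real (EC' ∩ EY')) + (1 - μ.real EC') * (1 - μ.real EK' - μ.real EY' + μ.real (EC' ∩ EY')) + (1 - μ.real EY') * (1 - μ.real EK' - μ.real EC' + μ.real (EC' ∩ EY'))) := by ring
    rw [e]; exact h32
  have key := row15_cutVertexAY_ineq (μ.real EK) (μ.real EA) (μ.real EG) (μ.real (EA ∩ EG)) (μ.real EK') (μ.real EC') (μ.real EY') (μ.real (EC' ∩ EY'))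
    e10 e11 e12 e13 c14 e20 e21 e22 e23 c24 hb1_0 hb1_1 hb1_2 hb2_0 hb2_1 lb2
  rw [sahiE3_def, eXYZ, eX, eY, eZ, eYZ, eXZ, eXY]
  exact key.trans_eq (by ring)

end Summit.CriticalPhenomena.PercolationContinuityZ3.Theorems.FrontierDecRows

end
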